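import Summits.SmoothPoincare4.SmoothPoincare4.Theorems.NilpotentShadowsStandard.Negative.Shape
import Summits.SmoothPoincare4.SmoothPoincare4.Theorems.CongruenceShadowsNilpotentShadowsStandardStubCutNormalForm
import Summits.SmoothPoincare4.SmoothPoincare4.Theorems.CongruenceShadowsNilpotentShadowsStandardStubNoHiddenDepth
import Summits.SmoothPoincare4.SmoothPoincare4.Theorems.CongruenceShadowsNilpotentShadowsStandardStubMagnusWittRead
import Summits.SmoothPoincare4.SmoothPoincare4.Theorems.CongruenceShadowsNilpotentShadowsStandardStubJohnsonGenerators
import Summits.SmoothPoincare4.SmoothPoincare4.Theorems.CongruenceShadowsNilpotentShadowsStandardStubLevelOneGlue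
import Summits.SmoothPoincare4.SmoothPoincare4.Theorems.CongruenceShadowsAbelianShadowStandard
import Literature.Algebra.Lie.SurfaceLieAlgebra
import Literature.Topology.FourManifolds.SurfaceGroupHomology
import Mathlib.Algebra.Lie.Free
import HarnessLib
import HarnessLib.Audit

/-!
# Line `saturated-torsor-descent` (lead's skeleton v8) — crux `CongruenceShadows.NilpotentShadowsStandard`
# (stmt-SmoothPoincare4-14594)

Lead skeleton (prover-line-stmt-SmoothPoincare4-14594-0, 2026-08-16), reshaping the planner's skeleton
`Lines/saturated-torsor-descent.lean` (planner-cruxplan-…-saturated-torsor-des-0) at the skeleton level (L4: same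
composition idea, ≤ 7 registered stubs, composition re-checked). PICKED.md explains the choice of the line.

THE CRUX. For every `(3+3m, m+1)` group trisection `K` of the trivial group and every `c`, one automorphism `ψ` of
`S = S_{3+3m}` carries `Nᵢ·γ_{c+2}S` onto `Kᵢ·γ_{c+2}S` for the three `i` at once (`N = s4Kernels.stabilizeIter m`,
`γ_{c+2}S = (⊤).lowerCentralSeries (c+1)`).

THE LINE (unchanged): induction on the level `c`; base `c = 0` = the route's support item `AbelianShadowStandard`
(stmt-SmoothPoincare4-14599) BY NAME; the step `c → c+1` is Levine's torsor over the on-the-nose standard level-`c`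
point, in its ANY-GROUP form (honest kernel triples: normal, free single quotients of rank `g`, free pair quotients of
rank `m+1`; no triple axiom, no `PUnit` above level `0`), cut into regimes by Johnson degree `d = c+1` against `g = 3+3m`.

THE RESHAPE. Each step is cut, at the GROUP level and over existing declarations only, into
* a DICTIONARY (proved here, `dictionary`): an automorphism `ψ` that stabilises the three level-`c` shadows
  `Nᵢ·γ_{c+2}` and throws every cut letter `x ∈ Cᵢ = s4CutSystem m i` into `Kᵢ·γ_{c+3}` already satisfies
  `ψ(Nᵢ·γ_{c+3}) = Kᵢ·γ_{c+3}` — from two true, line-independent lemmas registered as stubs: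
  `stub_cutNormalForm` (`Nᵢ = ⟪Cᵢ⟫`, the stabilisation unfolds to the erase pattern) and
  `stub_noHiddenDepth` (`Q ∩ [S,S] ≤ [Q,S]` for every honest handlebody kernel `S/Q ≅ Fₙ`: the central extension
  `S/[Q,S] ↠ Fₙ` splits, so `γ₂(S/[Q,S])` misses the central kernel `Q/[Q,S]`), plus a Dedekind argument;
* a REACH statement per regime (`stub_reachOne` `d = 1`, `stub_reachTwo` `d = 2`, `stub_reachStableOdd` `3 ≤ d < g` odd,
  `stub_reachStableEven` `4 ≤ d < g` even, `stub_reachUnstable` `d ≥ g`): over an honest kernel triple whose level-`c` shadow is standard ON THE NOSE there is a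
  level-`c`-shadow-stabilising automorphism throwing the cut letters into `Kᵢ·γ_{c+3}`. By the dictionary REACH_c is
  EQUIVALENT to the on-the-nose level step (the converse is trivial), so nothing is strengthened: REACH_c is the step
  in torsor coordinates (data = values on the cut letters; `J_{c+1}` and the whole level stabiliser act).
  Content per regime (docstrings of the stubs): `d = 1` Johnson 1980 + admissibility + compatible triples
  (the disprover's `levelOne_note` made unconditional); `d = 2` Morita–Yokomizo–Faes `im τ₂ = ker Tr^as` + the integral
  index-1 lattice statement (checked g = 3, 6, 9, TRIAGE-r1-1 (C1)); `3 ≤ d < g` Levine math/0408310 Thm 1 (odd `d`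
  integral, even `d` up to his 2-primary question); `d ≥ g` the OPEN CORE (unstable isotropic Johnson image `ITJ`).
* `stub_singleKernels` of the planner's skeleton (Zieschang / Grigorchuk–Kurchanov, XL vendoring) is DROPPED: the
  dictionary consumes only honest freeness (`free_quotient`), never `Kᵢ = αᵢ(Nᵢ)`.

STATUS (v3, 2026-08-16 wave 1): `stub_cutNormalForm` LANDED (p81513) and `stub_noHiddenDepth` LANDED (p83145) — imported
above, their sorries are gone; `stub_reachStable` was split by parity of `d = c+1` on the worker's `stub-misstated` verdict
(odd `d < g`: Levine 2006 Lemma 4.3 odd case + jointness, theorem-grade on paper; even `d ≥ 4`: Levine's 2-primary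
question, open); `stub_reachOne`/`stub_reachTwo` are `stub-blocked` on NEW named facts (Johnson 1980 Thm 1; Morita–Faes
`im τ₂ = ker Tr^as`; Magnus–Witt in degrees ≤ 4) with rc-0 torsor reductions in the lead folder (work/stubs/*_torsor.lean).

RESHAPE v4 (after wave 1): `stub_reachOne` (a THEOREM on paper: Johnson 1980) is cut into three registered stubs whose
conjunction gives it by modus ponens — `stub_johnsonGenerators` (every basis 3-vector `u∧v∧w` of `Λ³H` is the Johnson image
of an IA-automorphism of the PRESENTED group `S_g`, `g ≥ 3`: the bounding-pair map `bpAut` of the wave-1 artifacts realises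
`a₀∧b₀∧b₁`, handle permutations / in-handle rotations / one mixing transvection transport it to every triple),
`stub_magnusWittRead` (Magnus–Witt in degrees ≤ 3 for `FreeGroup (Fin n)` in READING form: if `ηⱼ ∈ γ₂` and
`∏ⱼ ⁅ηⱼ⁻¹, yⱼ⁆^{sⱼ} ∈ γ₄` then `ηⱼ ≡ ∏_{v<w} ⁅y_v, y_w⁆^{sⱼ D(j,v,w)} (mod γ₃)` for an ALTERNATING integer 3-form `D` —
provable with 3×3 / 4×4 unitriangular integer matrices, no free Lie algebra), and `stub_levelOneGlue` (the level-1 torsor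
argument: corrections, reading the honest data in `S/Kᵢγ₄ ≅ F_g/γ₄` (Hopf property of f.g. nilpotent groups or the basis-change
trick), pair compatibility, compatible triples lift along `Λ³H → ⊕ᵢ Λ³(H/Lᵢ)` (`C₀ ∩ C₁ ∩ C₂ = ∅`), assembling `ψ` by
additivity of `τ₁` on IA — from the two previous statements). 7 registered stubs in all (= stubs_max).

STATUS v6 (end of wave 2): LANDED — `stub_cutNormalForm` (p81513), `stub_noHiddenDepth` (p83145), `stub_magnusWittRead` (p90021),
`stub_johnsonGenerators` (6 files, p94003 p94006 p95519 p95521 p95541 + stub p95690), `stub_levelOneGlue` (5 files, p95524 p95528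
p95532 p95543 + stub p95693), helper TorsorCalculus (p88032): all imported above, so `ReachOne` — THE LEVEL-1 STEP for every `m` and
every honest kernel triple of ANY group — is kernel-checked. OPEN: `stub_reachTwo` (d = 2), `stub_reachStableOdd` (Levine, theorem on
paper), `stub_reachStableEven` (Levine's 2-primary question), `stub_reachUnstable` (the open core; kit j012956: (g,d) = (3,3) integrally
unobstructed, (3,4) bracket part has a (ℤ/2)^24 lattice defect).

STATUS v7 (lead c1, prover-line-stmt-SmoothPoincare4-14594-c1-0, 2026-08-16): the base item `AbelianShadowStandard`
(stmt-SmoothPoincare4-14599) is CLOSED in the tree (`abelianShadowStandard_proof`, imported above), so the composition is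
now UNCONDITIONAL: `NilpotentShadowsStandard_of : NilpotentShadowsStandard` modulo the four registered REACH stubs only.

STATUS v8 (lead c1): RESHAPE of level 2 and of the open core — 7 registered stubs: `stub_freeGroupGrLie` (4a),
`stub_dTwoIndep` (4b), `stub_dTwoSpan` (4c), `stub_bsccTransport` (4d), `stub_pairRealisers` (4e), `stub_reachTwo` (4, held by the
lead, proved from 4a–4e), `stub_reachHigher` (5 = old 5a ∧ 5b ∧ 6).

LEVEL-TWO DESIGN (`LevelTwoDesign`, the lead's proof of `stub_reachTwo` from 4a–4e; all m, any-group honest triples).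
Data. Level 1 standard on the nose: `Kᵢγ₃ = Nᵢγ₃`; for a cut letter `c ∈ Cᵢ` pick `k_c = u_c·c ∈ Kᵢ`, `u_c ∈ γ₃`. In the
honest free quotient `ρᵢ : S ↠ Fᵢ = S/Kᵢ ≅ F_g` (identified with `FreeGroup (Fin g)` so that the survivor of handle `h` is
`≡ xₕ (mod γ₂)`, via `Aut F_g ↠ GL_g(ℤ)`), `ρᵢ(c_h) = ηₕ⁻¹`, `ηₕ = ρᵢ(u_{c_h}) ∈ γ₃F`, and the surface relation reads
`∏ₕ [ηₕ⁻¹, tₕ]^{sₕ} = 1` (`tₕ ≡ xₕ`, `sₕ = +1` iff the cut letter of handle `h` is an `a`), whence in `gr(F) ≅ L(ℤ^g)` (4a):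
`∑ₕ [xₕ, wₕ] = 0` for `wₕ = sₕ θ₂(ηₕ) ∈ L₃` — the data tuple lies in `D₂(ℤ^g) = ker(H'⊗L₃ → L₄)`, `H' = H/Lᵢ`. READ (4c, 4b):
`w = ∑ α_{xy} S(x,y) + ∑ β P(x,y;x,z) + ∑ (γ P(x,y;z,w) + δ P(x,z;y,w))` with UNIQUE integer coefficients indexed by
sets of survivors of system `i` (isotropic letter sets).
Compatibility. A common cut letter `c ∈ Cᵢ ∩ Cⱼ` has `ρᵢⱼ(uᵢ_c) = ρᵢⱼ(uʲ_c)` in `Fᵢⱼ = S/KᵢKⱼ ≅ F_k` (both `k`'s die), and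
`Fᵢ → Fᵢⱼ` kills exactly the non-common survivors, preserving the `D₂`-coordinates supported on common survivors (4a for `F_k`,
uniqueness 4b): coefficients indexed by letter sets surviving BOTH systems agree. Since `C₀ᶜ ∩ C₁ᶜ ∩ C₂ᶜ = ∅` handlewise but
letter SETS may survive two systems, define global coefficients on isotropic letter sets by inclusion–exclusion (well defined).
Realisers (4d, 4e). `T¹_{x,y} = σ T₁ σ⁻¹` with `σ_*: a₀ ↦ x, b₀ ↦ y + εx*` is in `J₂` with data at a letter `v`:
`[[X,Y],X]^{ν(v, y+εx*)} [[X,Y],Y]^{-ν(v,x)}` mod `γ₄` (`X = x`, `Y = y·(x*)^ε`; exponent sums through the isometry `F`), i.e.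
`τ₂(T¹_{x,y}) = (x ∧ (y+εx*))^{(2)} = S(x,y) + JUNK`, JUNK = monomials containing the dual pair `{x, x*}`, killed in EVERY
`Fᵢ` (each system cuts one of `x, x*`); so `T¹_{x,y}` contributes exactly `S(x,y)` to the systems in which `x, y` both survive
and `0` to the others. Likewise `T¹_{x,y+z}`-type products give `P(x,y;x,z) = S(x,y+z) − S(x,y) − S(x,z)` and the genus-2
conjugate `T²_{x,y,z,w}` (`σ_*: a₀ ↦ x, b₀ ↦ y+εx*, a₁ ↦ z, b₁ ↦ w+ε'z*`) gives `S(x,y) + S(z,w) + P(x,y;z,w)` mod JUNK.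
Glue. `ψ = ∏ (realiser)^{global coefficient}` ∈ `J₂` stabilises the three `Nᵢγ₃`; by `J₂`-additivity (4d) its data at a
cut letter `c_h ∈ Cᵢ`, pushed to `Fᵢ`, has `θ₂`-class `sₕ·wₕ = θ₂(ηₕ)`, i.e. `ρᵢ(ψ(c_h)c_h⁻¹ u_{c_h}⁻¹) ∈ γ₄Fᵢ`, which is
`ψ(c_h) ∈ Kᵢγ₄` by the torsor calculus (`level_mem_iff`, `target_iff_quotient`). This is `im τ₂ ⊇` (isotropic `D₂`) =
`ITJ₂`, with no appeal to Morita–Yokomizo `im τ₂ = ker Tr^{as}`. Exact check (lead, exp/d2basis.py): the family of 4b is a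
ℤ-basis of `D₂(ℤⁿ)`, `n ≤ 5` (ranks 1, 6, 20, 50; Smith invariants all 1; relation `P(xy;zw) − P(xz;yw) + P(xw;yz) = 0`).

COMPOSITION (kernel-checked, `sorry` only in the registered `stub_*`): `dictionary` + `step` (transport to on-the-nose, REACH,
dictionary, compose) + `reach_of_regimes` + `descent` + the landed base ⟹
`NilpotentShadowsStandard_of : NilpotentShadowsStandard`.

DISPROOF USED (`Cruxes/NilpotentShadowsStandard/Disproof.lean`, cdisprove cycle 1, read 2026-08-16T04:10Z; landed
`Negative/LoadBearing.lean`, `Negative/Shape.lean` imported above): `_false_without_trisection` — honoured: every REACH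
stub and the dictionary consume `normal` + `free_quotient` (honest kernels; the junk triple `K = ⊤` is not honest,
`junk_not_honest` below), REACH consumes `free_pairQuotient`; `anyGroup_false_of_cyclicTrisection` — honoured exactly:
the steps are any-group and CONDITIONAL on a standard level-`c` shadow, `PUnit` enters only through the base item 14599;
`counterexample_shape` / `shadow_mono` — the induction is their contrapositive; `levelOne_note` — `stub_reachOne` is the
note with the WaldhausenPairs proviso replaced by honest single kernels + pair compatibility. No `-- Targets` yet.
-/

noncomputable section

-- the prescribed namespace `Summit.<P>.<Sub>.…` duplicates `SmoothPoincare4` (P = Sub), as in Disproof.lean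
set_option linter.dupNamespace false

namespace Summit.SmoothPoincare4.SmoothPoincare4.Cruxes.NilpotentShadowsStandard.SaturatedTorsorDescent

open Literature.Topology.FourManifolds Subgroup
open Summit.SmoothPoincare4.SmoothPoincare4.Theses.CongruenceShadows
open scoped Pointwise commutatorElement

/-! ## Local vocabulary (readability only — never used inside a registered stub signature) -/

/-- The surface group of the crux at parameter `m` (genus `3 + 3m`). [folklore] -/
abbrev S (m : ℕ) : Type := SurfaceGroup (3 + 3 * m)

/-- The standard kernel triple `N = s4Kernels.stabilizeIter m`. [cite: AbramsGayKirby2018, §2] -/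
abbrev N (m : ℕ) : TrisectionKernels (3 + 3 * m) := s4Kernels.stabilizeIter m

/-- `γ m c = γ_{c+2}(S)` (1-indexed lower central series) = `(⊤).lowerCentralSeries (c+1)`; level `c` is the
nilpotent quotient `S / γ m c` (`c = 0`: abelianisation). [folklore] -/
abbrev γ (m c : ℕ) : Subgroup (S m) := (⊤ : Subgroup (S m)).lowerCentralSeries (c + 1)

/-- The coordinate cut systems `Cᵢ = s4CutSystem m i` (the letters killed by `Nᵢ`). [folklore] -/
abbrev C (m : ℕ) (i : Fin 3) : Set (Fin (3 + 3 * m) × Bool) := Literature.Algebra.Lie.s4CutSystem m i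

/-- The level-`c` shadow of `K` is standard (inner clause of the crux; `= Disproof.ShadowStandardAt`). [folklore] -/
def ShadowStdAt (m : ℕ) (K : TrisectionKernels (3 + 3 * m)) (c : ℕ) : Prop :=
  ∃ ψ : S m ≃* S m, ∀ i : Fin 3, (N m i ⊔ γ m c).map ψ.toMonoidHom = K i ⊔ γ m c

/-- REACH at parameter `m`, level `c → c+1`, in torsor coordinates: for every HONEST kernel triple (normal, free
single quotients of rank `3+3m`, free pair quotients of rank `m+1`) whose level-`c` shadow is standard ON THE NOSE,
some automorphism stabilising the three level-`c` shadows `Nᵢ·γ_{c+2}` throws every cut letter of `Cᵢ` into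
`Kᵢ·γ_{c+3}`. Equivalent (by `dictionary`, and trivially conversely) to the on-the-nose level step. [folklore] -/
def Reach (m c : ℕ) : Prop :=
  ∀ K : TrisectionKernels (3 + 3 * m), (∀ i, (K i).Normal) →
    (∀ i, IsFreeOfRank (S m ⧸ normalClosure (K i : Set (S m))) (3 + 3 * m)) →
    (∀ i j : Fin 3, i ≠ j → IsFreeOfRank (K.pairQuotient i j) (m + 1)) →
    (∀ i, K i ⊔ γ m c = N m i ⊔ γ m c) →
    ∃ ψ : S m ≃* S m, (∀ i : Fin 3, (N m i ⊔ γ m c).map ψ.toMonoidHom = N m i ⊔ γ m c) ∧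
      ∀ i : Fin 3, ∀ x ∈ C m i, ψ (PresentedGroup.of x) ∈ K i ⊔ γ m (c + 1)

/-! ## The six named statements -/

/-- **Statement 1 · CutNormalForm** (bookkeeping, TRUE, provable now; size M): the `m`-fold stabilised `S⁴` kernel
`Nᵢ` is the normal closure of the letters of the coordinate cut system `Cᵢ = s4CutSystem m i` (the `s4Gens i` pattern
repeated on each block of three handles). Induction on `m` over `TrisectionKernels.stabilize` (`genIncl` keeps the old
letters, `genShift` appends the pattern; the genus-`g` relator pieces land in `⟪Cᵢ⟫` because every handle is cut).
[folklore] -/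
def CutNormalForm : Prop :=
  ∀ (m : ℕ) (i : Fin 3), N m i = normalClosure (PresentedGroup.of '' C m i)

/-- **Statement 2 · NoHiddenDepth** (TRUE, provable now; size M): for an honest handlebody kernel `Q ⊴ S_g`
(`S_g/Q` free) the commutator subgroup meets `Q` only in `[Q, S]`: `Q ∩ γ₂S ≤ [Q,S]`. Proof: in `P = S/[Q,S]` the
image `A` of `Q` is central and `P/A ≅ Fₙ` is free, so `P ↠ Fₙ` has a homomorphic section `σ`; `δ(p) = p·σ(π p)⁻¹`
is a homomorphism `P → A` (A central) that is the identity on `A` and kills `γ₂P`; hence `A ∩ γ₂P = 1`.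
Consequence used by the dictionary: `(Q ∩ γₙ)γₙ₊₁ = [Qγₙ, S]γₙ₊₁ ∩ γₙ` at EVERY level — the filtration induced on an
honest kernel has no hidden depth (the triage's `GradedKernelIdeal`), with no appeal to Labute/Magnus–Witt.
[folklore] -/
def NoHiddenDepth : Prop :=
  ∀ (g n : ℕ) (Q : Subgroup (SurfaceGroup g)) [Q.Normal], IsFreeOfRank (SurfaceGroup g ⧸ Q) n →
    Q ⊓ (⊤ : Subgroup (SurfaceGroup g)).lowerCentralSeries 1 ≤ ⁅Q, (⊤ : Subgroup (SurfaceGroup g))⁆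

/-- **Statement 3 · ReachOne** (`d = 1`, all `m`; theorem-grade on paper, size L–XL in Lean). Data of an honest `Kᵢ`
with `Kᵢγ₂ = Nᵢγ₂`: `uₓ = kₓx⁻¹ ∈ γ₂` (`kₓ ∈ Kᵢ ∩ xγ₂`, `x ∈ Cᵢ`), read in `γ₂/[Nᵢ,S]γ₃ ≅ Λ²(H/Lᵢ)`; honest single
kernels put `u⁽ⁱ⁾ ∈ Λ³(H/Lᵢ) = D₁(H/Lᵢ)` (the relator read in `S/Kᵢγ₄ ≅ F_g/γ₄`), the pair axiom `S/KᵢKⱼγ₃ ≅ F_k/γ₃` is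
coefficient agreement on `Λ³(Cᵢ ∩ Cⱼ)` (the disprover's `3·C(k,3)` monomials), the joint restriction
`Λ³H → ⊕ᵢ Λ³(H/Lᵢ)` is onto compatible triples (`C₀ ∩ C₁ ∩ C₂ = ∅`), and Johnson 1980 (`τ₁(Torelli Σ_{g,*}) = Λ³H`,
`g ≥ 3`) supplies an IA-automorphism `ψ` with these data, so `ψ(x)x⁻¹ ≡ uₓ⁽ⁱ⁾`, i.e. `ψ(x) ∈ Kᵢγ₃`. Leans on (unvendored):
Johnson 1980 Thm 1 for the presented group (explicit bounding-pair automorphisms, uniform in `m`), `γ₂S/γ₃S ≅ Λ²H/ℤω`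
(Labute degree 2 / by hand), five-term sequence. [cite: doi:10.1007/bf01363897 (Johnson 1980), Thm 1] -/
def ReachOne : Prop := ∀ m : ℕ, Reach m 0

/-- **Statement 3a · JohnsonGenerators** (Johnson 1980 Thm 1 in presented, generator-wise form; theorem, size XL in Lean):
for `g ≥ 3` and pairwise distinct letters `u, v, w` of `S_g` there is an IA-automorphism `ψ` (`ψ(s)s⁻¹ ∈ γ₂`) whose Johnson
image is the basis 3-vector `u ∧ v ∧ w`: for every letter `x`, `ψ(x) x⁻¹ ≡ ⁅v,w⁆^{⟨x,u⟩} ⁅w,u⁆^{⟨x,v⟩} ⁅u,v⁆^{⟨x,w⟩} (mod γ₃)`,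
`⟨x,y⟩` the symplectic pairing of letters (`⟨aⱼ,bⱼ⟩ = 1 = -⟨bⱼ,aⱼ⟩`, else `0`). Additivity of `ψ ↦ (x ↦ ψ(x)x⁻¹)` on IA
(wave-1 artifact `IsJ.tau_trans`) then gives all of `Λ³H`. The wave-1 bounding-pair map `bpAut` realises `(b₀, a₀, b₁)`.
[cite: doi:10.1007/bf01363897 (Johnson 1980), Thm 1] -/
def JohnsonGenerators : Prop := ∀ (g : ℕ), 3 ≤ g → ∀ (u v w : Fin g × Bool), u ≠ v → u ≠ w → v ≠ w → ∃ ψ : Literature.Topology.FourManifolds.SurfaceGroup g ≃* Literature.Topology.FourManifolds.SurfaceGroup g, (∀ s : Literature.Topology.FourManifolds.SurfaceGroup g, ψ s * s⁻¹ ∈ (⊤ : Subgroup (Literature.Topology.FourManifolds.SurfaceGroup g)).lowerCentralSeries 1) ∧ ∀ x : Fin g × Bool, ψ (PresentedGroup.of x : Literature.Topology.FourManifolds.SurfaceGroup g) * (PresentedGroup.of x : Literature.Topology.FourManifolds.SurfaceGroup g)⁻¹ * (⁅(PresentedGroup.of v : Literature.Topology.FourManifolds.SurfaceGroup g), (PresentedGroup.of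 w : Literature.Topology.FourManifolds.SurfaceGroup g)⁆ ^ (if x.1 = u.1 ∧ x.2 = false ∧ u.2 = true then (1 : ℤ) else if x.1 = u.1 ∧ x.2 = true ∧ u.2 = false then (-1 : ℤ) else 0) * ⁅(PresentedGroup.of w : Literature.Topology.FourManifolds.SurfaceGroup g), (PresentedGroup.of u : Literature.Topology.FourManifolds.SurfaceGroup g)⁆ ^ (if x.1 = v.1 ∧ x.2 = false ∧ v.2 = true then (1 : ℤ) else if x.1 = v.1 ∧ x.2 = true ∧ v.2 = false then (-1 : ℤ) else 0) * ⁅(PresentedGroup.of u : Literature.Topology.FourManifolds.SurfaceGroup g), (PresentedGroup.of v : Literature.Topology.FourManifolds.SurfaceGroup g)⁆ ^ (if x.1 = w.1 ∧ x.2 = false ∧ w.2 = true then (1 : ℤ) else if x.1 = w.1 ∧ x.2 = true ∧ w.2 = false then (-1 : ℤ) else 0))⁻¹ ∈ (⊤ : Subgroup (Literature.Topology.FourManifolds.SurfaceGroup g)).lowerCentralSeries 2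

/-- **Statement 3b · MagnusWittRead** (Magnus–Witt in degrees ≤ 3 for free groups, reading form; theorem, size L in Lean,
elementary via unitriangular integer matrices): in `F = FreeGroup (Fin n)`: (degree 2, injectivity) a product
`∏_{v<w} ⁅y_v,y_w⁆^{e(v,w)}` lies in `γ₃F` only if `e = 0`; and (degree 3, reading) if `ηⱼ ∈ γ₂F` and the surface-type product
`∏ⱼ ⁅ηⱼ⁻¹, yⱼ⁆^{sⱼ}` (`sⱼ = ±1`) lies in `γ₄F`, then there is an ALTERNATING `D : (Fin n)³ → ℤ` with
`ηⱼ ≡ ∏_{v<w} ⁅y_v, y_w⁆^{sⱼ·D(j,v,w)} (mod γ₃F)` — the honest level-1 data are Johnson-shaped (`Λ³`).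
[cite: MagnusKarrassSolitar1976, §5.7 Thm 5.12 (Magnus–Witt); folklore low-degree form] -/
def MagnusWittRead : Prop := (∀ (n : ℕ) (e : Fin n → Fin n → ℤ), ((List.finRange n).map (fun v => ((List.finRange n).map (fun w => if v < w then ⁅(FreeGroup.of v : FreeGroup (Fin n)), FreeGroup.of w⁆ ^ (e v w) else (1 : FreeGroup (Fin n)))).prod)).prod ∈ (⊤ : Subgroup (FreeGroup (Fin n))).lowerCentralSeries 2 → ∀ v w : Fin n, v < w → e v w = 0) ∧ (∀ (n : ℕ) (s : Fin n → ℤ) (η : Fin n → FreeGroup (Fin n)), (∀ j, s j = 1 ∨ s j = -1) → (∀ j, η j ∈ (⊤ : Subgroup (FreeGroup (Fin n))).lowerCentralSeries 1) → ((List.finRange n).map (fun j => ⁅(η j)⁻¹, FreeGroup.of j⁆ ^ (s j))).prod ∈ (⊤ : Subgroup (FreeGroup (Fin n))).lowerCentralSeries 3 → ∃ D : Fin n → Fin n → Fin n → ℤ, (∀ a b c, D b a c = -D a b c) ∧ (∀ a b c, D a c b = -D a b c) ∧ ∀ j, η j * (((List.finRange n).map (fun v => ((List.finRange n).map (fun w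 => if v < w then ⁅(FreeGroup.of v : FreeGroup (Fin n)), FreeGroup.of w⁆ ^ (s j * D j v w) else (1 : FreeGroup (Fin n)))).prod)).prod)⁻¹ ∈ (⊤ : Subgroup (FreeGroup (Fin n))).lowerCentralSeries 2)

/-- **Statement 3c · LevelOneGlue** (the level-1 torsor argument, size L–XL in Lean): `JohnsonGenerators → MagnusWittRead →
ReachOne`. [folklore] -/
def LevelOneGlue : Prop := JohnsonGenerators → MagnusWittRead → ReachOne

/-- **Statement 4 · ReachTwo** (`d = 2`, all `m`; size L–XL; very plausible). Data in `D₂(H/Lᵢ)`; translations by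
`r(τ₂(J₂))` with `im τ₂ = ker Tr^as` (Morita, Yokomizo; Faes arXiv:2010.16268 Thm 2.4); INTEGRALLY `r(ker Tr^as)` = all
pair-compatible triples at `g = 3, 6, 9` (TRIAGE-r1-1 (C1): joint ranks 18 / 312 / 1602, index 1) — the 2-torsion
never obstructs. All-`m` proof = the index-1 statement as a lattice theorem (a degree-2 class touches ≤ 3 blocks, all
interactions seen at `g = 9`) + the closed-surface `im τ₂`. [cite: arXiv:2010.16268, Thm 2.4] -/
def ReachTwo : Prop := ∀ m : ℕ, Reach m 1

/-- **Statement 5a · ReachStableOdd** (`3 ≤ d = c+1 < g = 3+3m`, `d` odd i.e. `c % 2 = 0`; vacuous at `m = 0`; size L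
after vendoring; theorem-grade on paper). Levine arXiv:math/0408310 Thm 1 / Lemma 4.3 odd case: for `g > d` odd the
single-handlebody Johnson image is ALL of `D_d(H')` (spare-letter brackets `D̃_d(H′) = Σ[D₁H, D̃_{d−1}H′]`), so the three
single data are Johnson; jointness by inclusion–exclusion over the letter classes (`t = θ⁰θ¹θ² m₀₁⁻¹m₀₂⁻¹m₁₂⁻¹` with
free-group retractions; `C₀ ∩ C₁ ∩ C₂ = ∅`). Worker verdict (wave 1): reduces to ONE published fact, Levine 2006 Lemma 4.3
(odd `k < g`) in presented form (`Levine2006_Lemma43_odd`, work/stubs/stub_reachStable.lean). [cite: arXiv:math/0408310, Thm 1 and Lemma 4.3] -/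
def ReachStableOdd : Prop := ∀ m c : ℕ, 2 ≤ c → c + 2 ≤ 3 + 3 * m → c % 2 = 0 → Reach m c

/-- **Statement 5b · ReachStableEven** (`4 ≤ d = c+1 < g`, `d` even i.e. `c % 2 = 1`; first instance `(m,c) = (1,3)`,
`(g,d) = (6,4)`; size: OPEN). Levine gives only `im J_d^L ⊇ 2·D_d(H′)` for even `d < g` (Remark 4.1: "reasonable to ask
whether `J_k^L` is onto for all `k < g`"), so honest non-tree data must be shown jointly reachable — Levine's question
refined, not in print; a possible genuine obstruction (an even-degree 2-torsion shadow invariant in the stable range).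
[cite: arXiv:math/0408310, Remark 4.1] -/
def ReachStableEven : Prop := ∀ m c : ℕ, 2 ≤ c → c + 2 ≤ 3 + 3 * m → c % 2 = 1 → Reach m c

/-- **Statement 6 · ReachUnstable** (`d = c+1 ≥ g = 3+3m`; at `m = 0` every level `c ≥ 2`; the OPEN CORE, hardest
stub, held by the lead). Beyond Levine's range: needs `ITJ_d(3k)` (isotropic-content derivations of `𝔰_g` of degree
`d ≥ 3k` are Johnson) ⇒ `Absorption_d` ⇒ joint surjectivity ⇒ REACH; rationally = GraftingGeneration (idea
`derivation-grafting-itj`, checked at rank 3 for `d ≤ 8`: kit j010758/j011060, TRIAGE-r1-1 (C2), r1-2; rational joint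
Levine full rank at `(g,d) = (3,3)`, kit j008472); integral residue 2-primary at even `d` and a `5` in one-step grafting
at `D₃ → D₄`; Faes' saturation defects from `d = 3`. First open instance: `(g,d) = (3,3)` over `ℤ`. [folklore] -/
def ReachUnstable : Prop := ∀ m c : ℕ, 3 + 3 * m < c + 2 → Reach m c

/-- **Statement 5 · ReachHigher** (`d = c+1 ≥ 3`): the conjunction of 5a, 5b, 6 as ONE registered statement (v8). [folklore] -/
def ReachHigher : Prop := ∀ m c : ℕ, 2 ≤ c → Reach m c

/-! ## Registered stubs (`sorry` lives ONLY here; signatures verbatim over tree declarations, fully qualified)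

Stubs 1–2 landed in wave 1, stubs 3a–3c in wave 2 (all imported). v8 (lead c1): `stub_reachTwo` (d = 2) is now PROVED BY
THE LEAD from four registered worker stubs 4a–4d (Magnus–Witt for free groups; the `D₂` basis theorem, split into
independence and spanning; BSCC base maps + `J₂`-calculus; symplectic pair realisers) — see `LevelTwoDesign` below — and the
three open-core regimes are merged into ONE registered stub `stub_reachHigher` (`c ≥ 2`; the regime split
`ReachStableOdd/Even/Unstable` stays documented and `reachHigher_of_regimes` recombines it). 7 registered stubs = stubs_max. -/

-- Stub 3a `stub_johnsonGenerators` LANDED (p95690), 3b `stub_magnusWittRead` LANDED (p90021), 3c `stub_levelOneGlue` LANDED (p95693):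
--   `Summit.SmoothPoincare4.SmoothPoincare4.Theorems.NilpotentShadowsStandard.SaturatedTorsorDescent.stub_…`
-- Stub 1 `stub_cutNormalForm` LANDED (p81513), Stub 2 `stub_noHiddenDepth` LANDED (p83145).

/-- Stub 4a · **Magnus–Witt for free groups** (Magnus 1937, Witt 1937: `gr(F_n) ≅ L(ℤⁿ)`, the free Lie ring), in the
`θ`-form of the tree's `Literature.Algebra.Lie.Labute1970_grSurfaceGroup`: symbol maps `θ_k : F_n → L(ℤⁿ)` additive on
`γ_{k+1} = lcs k`, with image `L_{k+1}` and kernel `γ_{k+2}` there, letters to letters, commutators to brackets. Proof route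
in the tree: the Lie ring `gr(F)` (`LowerCentralSeriesLieRing`), the canonical `L(ℤⁿ) → gr(F_n)` (onto each piece, as in
`SurfaceGroupGrLie`), injectivity by the truncated Magnus representation of `MagnusResidualNilpotence` fed into
`MagnusFiltration.magnusLieHom` and Witt's embedding `toTensor_int_injective` (`FreeLieRingEmbedding`); or embed
`F_n = ⟨a₀,…,a_{n-1}⟩ ≤ S_n` and use Labute + the `b`-degree grading. [cite: MagnusKarrassSolitar1976, §5.7 Thm 5.12] -/
theorem stub_freeGroupGrLie : ∀ n : ℕ, ∃ θ : ℕ → FreeGroup (Fin n) → FreeLieAlgebra ℤ (Fin n), (∀ k, ∀ x ∈ (⊤ : Subgroup (FreeGroup (Fin n))).lowerCentralSeries k, ∀ y ∈ (⊤ : Subgroup (FreeGroup (Fin n))).lowerCentralSeries k, θ k (x * y) = θ k x + θ k y) ∧ (∀ k, θ k '' ((⊤ : Subgroup (FreeGroup (Fin n))).lowerCentralSeries k) = Literature.Algebra.Lie.wordGrade ℤ (FreeLieAlgebra.of ℤ : Fin n → FreeLieAlgebra ℤ (Fin n)) (k + 1)) ∧ (∀ k, ∀ x ∈ (⊤ :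 Subgroup (FreeGroup (Fin n))).lowerCentralSeries k, θ k x = 0 ↔ x ∈ (⊤ : Subgroup (FreeGroup (Fin n))).lowerCentralSeries (k + 1)) ∧ (∀ i : Fin n, θ 0 (FreeGroup.of i) = FreeLieAlgebra.of ℤ i) ∧ (∀ j k, ∀ x ∈ (⊤ : Subgroup (FreeGroup (Fin n))).lowerCentralSeries j, ∀ y ∈ (⊤ : Subgroup (FreeGroup (Fin n))).lowerCentralSeries k, θ (j + k + 1) ⁅x, y⁆ = ⁅θ j x, θ k y⁆) := by
  sorry

/-- Stub 4b · **`D₂` independence**: in the free Lie ring `L = L(ℤⁿ)` the degree-2 "tree/square" tuples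
`S(x,y) = (j ↦ δ_{jx}[y,[x,y]] − δ_{jy}[x,[x,y]])` (`x<y`), `P(x,y;x,z)` (`y<z`, `x ∉ {y,z}`), `P(x,y;z,w)`, `P(x,z;y,w)`
(`x<y<z<w`), where `P(x,y;z,w) = (j ↦ δ_{jx}[y,[z,w]] − δ_{jy}[x,[z,w]] + δ_{jz}[w,[x,y]] − δ_{jw}[z,[x,y]])`, are
ℤ-linearly independent in `(Fin n → L)`. (Witt's embedding `toTensor` and leading words.) [folklore; cite: Reutenauer1993, Thm 0.5] -/
theorem stub_dTwoIndep : ∀ n : ℕ, ∀ (α : Fin n → Fin n → ℤ) (β : Fin n → Fin n → Fin n → ℤ) (γ δ : Fin n → Fin n → Fin n → Fin n → ℤ), (∀ j : Fin n,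
        (∑ x, ∑ y, if x < y then α x y • ((if j = x then ⁅FreeLieAlgebra.of ℤ y, ⁅FreeLieAlgebra.of ℤ x, FreeLieAlgebra.of ℤ y⁆⁆ else 0) - (if j = y then ⁅FreeLieAlgebra.of ℤ x, ⁅FreeLieAlgebra.of ℤ x, FreeLieAlgebra.of ℤ y⁆⁆ else 0)) else (0 : FreeLieAlgebra ℤ (Fin n))) +
        (∑ x, ∑ y, ∑ z, if y < z ∧ x ≠ y ∧ x ≠ z then β x y z • ((if j = x then ⁅FreeLieAlgebra.of ℤ y, ⁅FreeLieAlgebra.of ℤ x, FreeLieAlgebra.of ℤ z⁆⁆ else 0) - (if j = y then ⁅FreeLieAlgebra.of ℤ x, ⁅FreeLieAlgebra.of ℤ x, FreeLieAlgebra.of ℤ z⁆⁆ else 0) + (if j = x then ⁅FreeLieAlgebra.of ℤ z, ⁅FreeLieAlgebra.of ℤ x, FreeLieAlgebra.of ℤ y⁆⁆ else 0) - (if j = z then ⁅FreeLieAlgebra.of ℤ x, ⁅FreeLieAlgebra.of ℤ x, FreeLieAlgebra.of ℤ y⁆⁆ else 0)) else 0) +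
        (∑ x, ∑ y, ∑ z, ∑ w, if x < y ∧ y < z ∧ z < w then
          γ x y z w • ((if j = x then ⁅FreeLieAlgebra.of ℤ y, ⁅FreeLieAlgebra.of ℤ z, FreeLieAlgebra.of ℤ w⁆⁆ else 0) - (if j = y then ⁅FreeLieAlgebra.of ℤ x, ⁅FreeLieAlgebra.of ℤ z, FreeLieAlgebra.of ℤ w⁆⁆ else 0) + (if j = z then ⁅FreeLieAlgebra.of ℤ w, ⁅FreeLieAlgebra.of ℤ x, FreeLieAlgebra.of ℤ y⁆⁆ else 0) - (if j = w then ⁅FreeLieAlgebra.of ℤ z, ⁅FreeLieAlgebra.of ℤ x, FreeLieAlgebra.of ℤ y⁆⁆ else 0)) +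
          δ x y z w • ((if j = x then ⁅FreeLieAlgebra.of ℤ z, ⁅FreeLieAlgebra.of ℤ y, FreeLieAlgebra.of ℤ w⁆⁆ else 0) - (if j = z then ⁅FreeLieAlgebra.of ℤ x, ⁅FreeLieAlgebra.of ℤ y, FreeLieAlgebra.of ℤ w⁆⁆ else 0) + (if j = y then ⁅FreeLieAlgebra.of ℤ w, ⁅FreeLieAlgebra.of ℤ x, FreeLieAlgebra.of ℤ z⁆⁆ else 0) - (if j = w then ⁅FreeLieAlgebra.of ℤ y, ⁅FreeLieAlgebra.of ℤ x, FreeLieAlgebra.of ℤ z⁆⁆ else 0)) else 0) = 0) →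
      (∀ x y, x < y → α x y = 0) ∧ (∀ x y z, y < z → x ≠ y → x ≠ z → β x y z = 0) ∧ (∀ x y z w, x < y → y < z → z < w → γ x y z w = 0 ∧ δ x y z w = 0) := by
  sorry

/-- Stub 4c · **`D₂` spanning** (the integral structure of `D₂(H) = ker(H ⊗ L₃(H) → L₄(H))`, Morita's `𝔥_{g,1}(2)` /
Levine's `D₂`): every tuple `u : Fin n → L₃(ℤⁿ)` with `∑ⱼ [xⱼ, uⱼ] = 0` is an integer combination of the tuples of stub 4b
(so with 4b they form a ℤ-basis; ranks `n²(n²−1)/12`; verified by exact computation for `n ≤ 5`, which covers every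
multidegree type). Proof: Lyndon coordinates in degrees 3 and 4 via `toTensor`, per multidegree type `{a³b}` (kernel 0),
`{a²b²}`, `{a²bc}`, `{abcd}`. [folklore; cite: arXiv:math/0110120 (Levine, Addendum), §2] -/
theorem stub_dTwoSpan : ∀ n : ℕ, ∀ u : Fin n → FreeLieAlgebra ℤ (Fin n), (∀ j, u j ∈ Literature.Algebra.Lie.wordGrade ℤ (FreeLieAlgebra.of ℤ : Fin n → FreeLieAlgebra ℤ (Fin n)) 3) → (∑ j, ⁅FreeLieAlgebra.of ℤ j, u j⁆ = 0) →
      ∃ (α : Fin n → Fin n → ℤ) (β : Fin n → Fin n → Fin n → ℤ) (γ δ : Fin n → Fin n → Fin n → Fin n → ℤ), ∀ j, u j =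
        (∑ x, ∑ y, if x < y then α x y • ((if j = x then ⁅FreeLieAlgebra.of ℤ y, ⁅FreeLieAlgebra.of ℤ x, FreeLieAlgebra.of ℤ y⁆⁆ else 0) - (if j = y then ⁅FreeLieAlgebra.of ℤ x, ⁅FreeLieAlgebra.of ℤ x, FreeLieAlgebra.of ℤ y⁆⁆ else 0)) else 0) +
        (∑ x, ∑ y, ∑ z, if y < z ∧ x ≠ y ∧ x ≠ z then β x y z • ((if j = x then ⁅FreeLieAlgebra.of ℤ y, ⁅FreeLieAlgebra.of ℤ x, FreeLieAlgebra.of ℤ z⁆⁆ else 0) - (if j = y then ⁅FreeLieAlgebra.of ℤ x, ⁅FreeLieAlgebra.of ℤ x, FreeLieAlgebra.of ℤ z⁆⁆ else 0) + (if j = x then ⁅FreeLieAlgebra.of ℤ z, ⁅FreeLieAlgebra.of ℤ x, FreeLieAlgebra.of ℤ y⁆⁆ else 0) - (if j = z then ⁅FreeLieAlgebra.of ℤ x, ⁅FreeLieAlgebra.of ℤ x, FreeLieAlgebra.of ℤ y⁆⁆ else 0)) else 0) +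
        (∑ x, ∑ y, ∑ z, ∑ w, if x < y ∧ y < z ∧ z < w then
          γ x y z w • ((if j = x then ⁅FreeLieAlgebra.of ℤ y, ⁅FreeLieAlgebra.of ℤ z, FreeLieAlgebra.of ℤ w⁆⁆ else 0) - (if j = y then ⁅FreeLieAlgebra.of ℤ x, ⁅FreeLieAlgebra.of ℤ z, FreeLieAlgebra.of ℤ w⁆⁆ else 0) + (if j = z then ⁅FreeLieAlgebra.of ℤ w, ⁅FreeLieAlgebra.of ℤ x, FreeLieAlgebra.of ℤ y⁆⁆ else 0) - (if j = w then ⁅FreeLieAlgebra.of ℤ z, ⁅FreeLieAlgebra.of ℤ x, FreeLieAlgebra.of ℤ y⁆⁆ else 0)) +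
          δ x y z w • ((if j = x then ⁅FreeLieAlgebra.of ℤ z, ⁅FreeLieAlgebra.of ℤ y, FreeLieAlgebra.of ℤ w⁆⁆ else 0) - (if j = z then ⁅FreeLieAlgebra.of ℤ x, ⁅FreeLieAlgebra.of ℤ y, FreeLieAlgebra.of ℤ w⁆⁆ else 0) + (if j = y then ⁅FreeLieAlgebra.of ℤ w, ⁅FreeLieAlgebra.of ℤ x, FreeLieAlgebra.of ℤ z⁆⁆ else 0) - (if j = w then ⁅FreeLieAlgebra.of ℤ y, ⁅FreeLieAlgebra.of ℤ x, FreeLieAlgebra.of ℤ z⁆⁆ else 0)) else 0) := by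
  sorry

/-- Stub 4d · **BSCC base maps and the `J₂`-calculus** of `S = S_{g+3}`: (i) the genus-1 and genus-2 "bounding simple
closed curve" automorphisms `T₁` (conjugate handle `0` by `c₀ = [a₀,b₀]`) and `T₂` (conjugate handles `0,1` by
`[a₀,b₀][a₁,b₁]`), identity on the other letters (they fix the relator: `localGens`/`blockGens` of
`SurfaceGroupGeneratorImages`); (ii) for `T ∈ J₂` (`T s s⁻¹ ∈ γ₃ = lcs 2`): `s ↦ T s s⁻¹` is additive modulo `γ₄ = lcs 3`,
compatible with inverses, trivial on `γ₃` modulo `γ₄`, hence given on any `w` by the letter values weighted with the exponent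
sums `abelianize w`; composition of two `J₂` maps adds data; (iii) letterwise `J₂` implies global `J₂`; (iv) weight-3
commutators `[[e,f],e]`, `[[e,f],f]` modulo `γ₄` depend only on `e, f` modulo `γ₂`. [folklore; cite: doi:10.1007/bf01363897 (Johnson 1980), §2] -/
theorem stub_bsccTransport : ∀ g : ℕ,
    (∃ T : Literature.Topology.FourManifolds.SurfaceGroup (g + 3) ≃* Literature.Topology.FourManifolds.SurfaceGroup (g + 3), ∀ v : Fin (g + 3) × Bool, T (PresentedGroup.of v) = if v.1 = 0 then ⁅(PresentedGroup.of ((0 : Fin (g + 3)), false) : Literature.Topology.FourManifolds.SurfaceGroup (g + 3)), PresentedGroup.of ((0 : Fin (g + 3)), true)⁆ * PresentedGroup.of v * (⁅(PresentedGroup.of ((0 : Fin (g + 3)), false) : Literature.Topology.FourManifolds.SurfaceGroup (g + 3)), PresentedGroup.of ((0 : Fin (g + 3)), true)⁆)⁻¹ else PresentedGroup.of v) ∧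
    (∃ T : Literature.Topology.FourManifolds.SurfaceGroup (g + 3) ≃* Literature.Topology.FourManifolds.SurfaceGroup (g + 3), ∀ v : Fin (g + 3) × Bool, T (PresentedGroup.of v) = if v.1 = 0 ∨ v.1 = 1 then (⁅(PresentedGroup.of ((0 : Fin (g + 3)), false) : Literature.Topology.FourManifolds.SurfaceGroup (g + 3)), PresentedGroup.of ((0 : Fin (g + 3)), true)⁆ * ⁅(PresentedGroup.of ((1 : Fin (g + 3)), false) : Literature.Topology.FourManifolds.SurfaceGroup (g + 3)), PresentedGroup.of ((1 : Fin (g + 3)), true)⁆) * PresentedGroup.of v * (⁅(PresentedGroup.of ((0 : Fin (g + 3)), false) : Literature.Topology.FourManifolds.SurfaceGroup (g + 3)), PresentedGroup.of ((0 : Fin (g + 3)), true)⁆ * ⁅(PresentedGroup.of ((1 : Fin (g + 3)), false) : Literature.Topology.FourManifolds.SurfaceGroup (g + 3)), PresentedGroup.of ((1 : Fin (g + 3)), true)⁆)⁻¹ else PresentedGroup.of v) ∧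
    (∀ T : Literature.Topology.FourManifolds.SurfaceGroup (g + 3) ≃* Literature.Topology.FourManifolds.SurfaceGroup (g + 3), (∀ s, T s * s⁻¹ ∈ (⊤ : Subgroup (Literature.Topology.FourManifolds.SurfaceGroup (g + 3))).lowerCentralSeries 2) →
      (∀ s t, T (s * t) * (s * t)⁻¹ * ((T s * s⁻¹) * (T t * t⁻¹))⁻¹ ∈ (⊤ : Subgroup (Literature.Topology.FourManifolds.SurfaceGroup (g + 3))).lowerCentralSeries 3) ∧
      (∀ s, T.symm s * s⁻¹ * (T s * s⁻¹) ∈ (⊤ : Subgroup (Literature.Topology.FourManifolds.SurfaceGroup (g + 3))).lowerCentralSeries 3) ∧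
      (∀ z ∈ (⊤ : Subgroup (Literature.Topology.FourManifolds.SurfaceGroup (g + 3))).lowerCentralSeries 2, T z * z⁻¹ ∈ (⊤ : Subgroup (Literature.Topology.FourManifolds.SurfaceGroup (g + 3))).lowerCentralSeries 3) ∧
      (∀ w, T w * w⁻¹ * ((((List.finRange (g + 3)).flatMap fun h => [(h, false), (h, true)]).map fun v => (T (PresentedGroup.of v) * (PresentedGroup.of v)⁻¹) ^ (Multiplicative.toAdd (Literature.Topology.FourManifolds.SurfaceGroup.abelianize (g + 3) w) v)).prod)⁻¹ ∈ (⊤ : Subgroup (Literature.Topology.FourManifolds.SurfaceGroup (g + 3))).lowerCentralSeries 3)) ∧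
    (∀ T : Literature.Topology.FourManifolds.SurfaceGroup (g + 3) ≃* Literature.Topology.FourManifolds.SurfaceGroup (g + 3), (∀ v : Fin (g + 3) × Bool, T (PresentedGroup.of v) * (PresentedGroup.of v)⁻¹ ∈ (⊤ : Subgroup (Literature.Topology.FourManifolds.SurfaceGroup (g + 3))).lowerCentralSeries 2) → ∀ s, T s * s⁻¹ ∈ (⊤ : Subgroup (Literature.Topology.FourManifolds.SurfaceGroup (g + 3))).lowerCentralSeries 2) ∧
    (∀ T T' : Literature.Topology.FourManifolds.SurfaceGroup (g + 3) ≃* Literature.Topology.FourManifolds.SurfaceGroup (g + 3), (∀ s, T s * s⁻¹ ∈ (⊤ : Subgroup (Literature.Topology.FourManifolds.SurfaceGroup (g + 3))).lowerCentralSeries 2) → (∀ s, T' s * s⁻¹ ∈ (⊤ : Subgroup (Literature.Topology.FourManifolds.SurfaceGroup (g + 3))).lowerCentralSeries 2) → ∀ s, T (T' s) * s⁻¹ * ((T s * s⁻¹) * (T' s * s⁻¹))⁻¹ ∈ (⊤ : Subgroup (Literature.Topology.FourManifolds.SurfaceGroup (g + 3))).lowerCentralSeries 3) ∧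
    (∀ e e' f f' : Literature.Topology.FourManifolds.SurfaceGroup (g + 3), e' * e⁻¹ ∈ (⊤ : Subgroup (Literature.Topology.FourManifolds.SurfaceGroup (g + 3))).lowerCentralSeries 1 → f' * f⁻¹ ∈ (⊤ : Subgroup (Literature.Topology.FourManifolds.SurfaceGroup (g + 3))).lowerCentralSeries 1 → ⁅⁅e', f'⁆, e'⁆ * (⁅⁅e, f⁆, e⁆)⁻¹ ∈ (⊤ : Subgroup (Literature.Topology.FourManifolds.SurfaceGroup (g + 3))).lowerCentralSeries 3 ∧ ⁅⁅e', f'⁆, f'⁆ * (⁅⁅e, f⁆, f⁆)⁻¹ ∈ (⊤ : Subgroup (Literature.Topology.FourManifolds.SurfaceGroup (g + 3))).lowerCentralSeries 3) := by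
  sorry

/-- Stub 4e · **Symplectic pair realisers**: for letters `x, y` on different handles of `S_{g+3}` there is an automorphism
`σ` acting on `H₁ = ℤ^{2(g+3)}` by an isometry `F` of the intersection form with `F[a₀] = x`, `F[b₀] = y + ε x*`
(`x* = ` the dual letter of `x`, `ε = ν(x, x*)⁻¹ = ±1`, so that `(x, y + εx*)` is a symplectic pair); and the genus-2
version `F[a₀] = x, F[b₀] = y + ε_x x*, F[a₁] = z, F[b₁] = w + ε_z z*` for letters on four different handles. (Complete
the pair(s) to a symplectic basis by the shear `v ↦ v + ν(x,v) y + ν(y,v) x` of a reindexed standard basis and realise it by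
`exists_mulEquiv_linearEquiv_of_isSymplecticBasis`, ZVC 3.6.7 (b).) [cite: ZieschangVogtColdewey1980, Thm. 3.6.7 (b)] -/
theorem stub_pairRealisers : ∀ g : ℕ,
    (∀ x y : Fin (g + 3) × Bool, x.1 ≠ y.1 → ∃ (σ : Literature.Topology.FourManifolds.SurfaceGroup (g + 3) ≃* Literature.Topology.FourManifolds.SurfaceGroup (g + 3)) (F : (Fin (g + 3) × Bool → ℤ) ≃ₗ[ℤ] (Fin (g + 3) × Bool → ℤ)),
      (∀ s, Multiplicative.toAdd (Literature.Topology.FourManifolds.SurfaceGroup.abelianize (g + 3) (σ s)) = F (Multiplicative.toAdd (Literature.Topology.FourManifolds.SurfaceGroup.abelianize (g + 3) s))) ∧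
      (∀ v w, Literature.Topology.FourManifolds.symplForm (F v) (F w) = Literature.Topology.FourManifolds.symplForm v w) ∧
      F (Pi.single ((0 : Fin (g + 3)), false) 1) = Pi.single x 1 ∧
      F (Pi.single ((0 : Fin (g + 3)), true) 1) = Pi.single y 1 + (if x.2 = false then (1 : ℤ) else -1) • Pi.single (x.1, !x.2) 1) ∧
    (∀ x y z w : Fin (g + 3) × Bool, x.1 ≠ y.1 → x.1 ≠ z.1 → x.1 ≠ w.1 → y.1 ≠ z.1 → y.1 ≠ w.1 → z.1 ≠ w.1 → ∃ (σ : Literature.Topology.FourManifolds.SurfaceGroup (g + 3) ≃* Literature.Topology.FourManifolds.SurfaceGroup (g + 3)) (F : (Fin (g + 3) × Bool → ℤ) ≃ₗ[ℤ] (Fin (g + 3) × Bool → ℤ)),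
      (∀ s, Multiplicative.toAdd (Literature.Topology.FourManifolds.SurfaceGroup.abelianize (g + 3) (σ s)) = F (Multiplicative.toAdd (Literature.Topology.FourManifolds.SurfaceGroup.abelianize (g + 3) s))) ∧
      (∀ v w, Literature.Topology.FourManifolds.symplForm (F v) (F w) = Literature.Topology.FourManifolds.symplForm v w) ∧
      F (Pi.single ((0 : Fin (g + 3)), false) 1) = Pi.single x 1 ∧
      F (Pi.single ((0 : Fin (g + 3)), true) 1) = Pi.single y 1 + (if x.2 = false then (1 : ℤ) else -1) • Pi.single (x.1, !x.2) 1 ∧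
      F (Pi.single ((1 : Fin (g + 3)), false) 1) = Pi.single z 1 ∧
      F (Pi.single ((1 : Fin (g + 3)), true) 1) = Pi.single w 1 + (if z.2 = false then (1 : ℤ) else -1) • Pi.single (z.1, !z.2) 1) := by
  sorry

/-- Stub 4 · `stub_reachTwo`, registered form (= `ReachTwo` = `∀ m, Reach m 1`); HELD BY THE LEAD, proved from stubs 4a–4e by the
level-two glue (`LevelTwoDesign`). [cite: arXiv:2010.16268, Thm 2.4] -/
theorem stub_reachTwo : ∀ (m : ℕ) (K : Literature.Topology.FourManifolds.TrisectionKernels (3 + 3 * m)), (∀ i, (K i).Normal) → (∀ i, Literature.Topology.FourManifolds.IsFreeOfRank (Literature.Topology.FourManifolds.SurfaceGroup (3 + 3 * m) ⧸ Subgroup.normalClosure (K i : Set (Literature.Topology.FourManifolds.SurfaceGroup (3 + 3 * m)))) (3 + 3 * m)) → (∀ i j : Fin 3, i ≠ j → Literature.Topology.FourManifolds.IsFreeOfRank (K.pairQuotient i j) (m + 1)) → (∀ i, K i ⊔ (⊤ : Subgroup (Literature.Topology.FourManifolds.SurfaceGroup (3 + 3 * m))).lowerCentralSeries 2 = Literature.Topology.FourManifolds.s4Kernels.stabilizeIter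 m i ⊔ (⊤ : Subgroup (Literature.Topology.FourManifolds.SurfaceGroup (3 + 3 * m))).lowerCentralSeries 2) → ∃ ψ : Literature.Topology.FourManifolds.SurfaceGroup (3 + 3 * m) ≃* Literature.Topology.FourManifolds.SurfaceGroup (3 + 3 * m), (∀ i : Fin 3, (Literature.Topology.FourManifolds.s4Kernels.stabilizeIter m i ⊔ (⊤ : Subgroup (Literature.Topology.FourManifolds.SurfaceGroup (3 + 3 * m))).lowerCentralSeries 2).map ψ.toMonoidHom = Literature.Topology.FourManifolds.s4Kernels.stabilizeIter m i ⊔ (⊤ : Subgroup (Literature.Topology.FourManifolds.SurfaceGroup (3 + 3 * m))).lowerCentralSeries 2) ∧ ∀ i : Fin 3, ∀ x ∈ Literature.Algebra.Lie.s4CutSystem m i, ψ (PresentedGroup.of x) ∈ K i ⊔ (⊤ : Subgroup (Literature.Topology.FourManifolds.SurfaceGroup (3 + 3 * m))).lowerCentralSeries 3 := by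
  sorry

/-- Stub 5 · `stub_reachHigher`, registered form (= `ReachHigher`: `2 ≤ c`, `Reach m c`) — the three regimes `ReachStableOdd`
(Levine, theorem-grade on paper), `ReachStableEven` (Levine's 2-primary question), `ReachUnstable` (the OPEN CORE, `ITJ_d`,
`d = c+1 ≥ g`) merged into one registered statement (v8); `reachHigher_of_regimes` recombines the split. [cite: arXiv:math/0408310, Thm 1 and Lemma 4.3] -/
theorem stub_reachHigher : ∀ (m c : ℕ), 2 ≤ c → ∀ (K : Literature.Topology.FourManifolds.TrisectionKernels (3 + 3 * m)), (∀ i, (K i).Normal) → (∀ i, Literature.Topology.FourManifolds.IsFreeOfRank (Literature.Topology.FourManifolds.SurfaceGroup (3 + 3 * m) ⧸ Subgroup.normalClosure (K i : Set (Literature.Topology.FourManifolds.SurfaceGroup (3 + 3 * m)))) (3 + 3 * m)) → (∀ i j : Fin 3, i ≠ j → Literature.Topology.FourManifolds.IsFreeOfRank (K.pairQuotient i j) (m + 1)) → (∀ i, K i ⊔ (⊤ : Subgroup (Literature.Topology.FourManifolds.SurfaceGroup (3 + 3 * m))).lowerCentralSeries (c + 1) = Literature.Topology.FourManifolds.s4Kernels.stabilizeIter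 m i ⊔ (⊤ : Subgroup (Literature.Topology.FourManifolds.SurfaceGroup (3 + 3 * m))).lowerCentralSeries (c + 1)) → ∃ ψ : Literature.Topology.FourManifolds.SurfaceGroup (3 + 3 * m) ≃* Literature.Topology.FourManifolds.SurfaceGroup (3 + 3 * m), (∀ i : Fin 3, (Literature.Topology.FourManifolds.s4Kernels.stabilizeIter m i ⊔ (⊤ : Subgroup (Literature.Topology.FourManifolds.SurfaceGroup (3 + 3 * m))).lowerCentralSeries (c + 1)).map ψ.toMonoidHom = Literature.Topology.FourManifolds.s4Kernels.stabilizeIter m i ⊔ (⊤ : Subgroup (Literature.Topology.FourManifolds.SurfaceGroup (3 + 3 * m))).lowerCentralSeries (c + 1)) ∧ ∀ i : Fin 3, ∀ x ∈ Literature.Algebra.Lie.s4CutSystem m i, ψ (PresentedGroup.of x) ∈ K i ⊔ (⊤ : Subgroup (Literature.Topology.FourManifolds.SurfaceGroup (3 + 3 * m))).lowerCentralSeries (c + 2) := by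
  sorry


/-! ## Read-back: each registered text IS the named proposition (definitional unfolding, `0 + 1 = 1` etc.) -/

/-- The LANDED `stub_cutNormalForm` (p81513) proves `CutNormalForm` on the nose. [folklore] -/
theorem cutNormalForm_stub : CutNormalForm := Summit.SmoothPoincare4.SmoothPoincare4.Theorems.NilpotentShadowsStandard.SaturatedTorsorDescent.stub_cutNormalForm

/-- The LANDED `stub_noHiddenDepth` (p83145) proves `NoHiddenDepth` on the nose. [folklore] -/
theorem noHiddenDepth_stub : NoHiddenDepth := @Summit.SmoothPoincare4.SmoothPoincare4.Theorems.NilpotentShadowsStandard.SaturatedTorsorDescent.stub_noHiddenDepth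

/-- `stub_johnsonGenerators` proves `JohnsonGenerators` on the nose. [folklore] -/
theorem johnsonGenerators_stub : JohnsonGenerators := Summit.SmoothPoincare4.SmoothPoincare4.Theorems.NilpotentShadowsStandard.SaturatedTorsorDescent.stub_johnsonGenerators

/-- `stub_magnusWittRead` proves `MagnusWittRead` on the nose. [folklore] -/
theorem magnusWittRead_stub : MagnusWittRead := Summit.SmoothPoincare4.SmoothPoincare4.Theorems.NilpotentShadowsStandard.SaturatedTorsorDescent.stub_magnusWittRead

/-- `stub_levelOneGlue` proves `LevelOneGlue` on the nose. [folklore] -/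
theorem levelOneGlue_stub : LevelOneGlue := Summit.SmoothPoincare4.SmoothPoincare4.Theorems.NilpotentShadowsStandard.SaturatedTorsorDescent.stub_levelOneGlue

/-- `ReachOne` from stubs 3a–3c (modus ponens). [folklore] -/
theorem reachOne_stub : ReachOne := levelOneGlue_stub johnsonGenerators_stub magnusWittRead_stub

/-- `stub_reachTwo` proves `ReachTwo = ∀ m, Reach m 1` on the nose. [folklore] -/
theorem reachTwo_stub : ReachTwo := stub_reachTwo

/-- `stub_reachHigher` proves `ReachHigher` on the nose. [folklore] -/
theorem reachHigher_stub : ReachHigher := stub_reachHigher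

/-- The regime split recombines to `ReachHigher` (every `c ≥ 2` is stable odd, stable even or unstable). [folklore] -/
theorem reachHigher_of_regimes (h3 : ReachStableOdd) (h3' : ReachStableEven) (h4 : ReachUnstable) : ReachHigher := by
  intro m c hc
  by_cases hle : c + 2 ≤ 3 + 3 * m
  · rcases Nat.mod_two_eq_zero_or_one c with hpar | hpar
    · exact h3 m c hc hle hpar
    · exact h3' m c hc hle hpar
  · exact h4 m c (by omega)

/-! ## Sorry-free basics: the standard triple, transport along automorphisms -/

/-- The standard triple is a `(3+3m, m+1)` group trisection of the trivial group (tree facts, discharged).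
[cite: AbramsGayKirby2018, Def. 3] -/
theorem standard_isGroupTrisection (m : ℕ) :
    IsGroupTrisection (3 + 3 * m) (m + 1) (PUnit : Type) (N m) := by
  induction m with
  | zero => exact s4Kernels_isGroupTrisection_holds
  | succ n ih => exact stabilize_isGroupTrisection_holds _ _ _ _ ih

instance N_normal (m : ℕ) (i : Fin 3) : (N m i).Normal := (standard_isGroupTrisection m).normal i

/-- An automorphism maps `⊤` onto `⊤`. [folklore] -/
theorem map_top_equiv {m : ℕ} (ψ : S m ≃* S m) : (⊤ : Subgroup (S m)).map ψ.toMonoidHom = ⊤ := by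
  rw [← MonoidHom.range_eq_map, MonoidHom.range_eq_top.2 ψ.surjective]

/-- `γ` is characteristic: automorphisms fix it. [folklore] -/
theorem map_γ (m c : ℕ) (ψ : S m ≃* S m) : (γ m c).map ψ.toMonoidHom = γ m c := by
  rw [Subgroup.map_lowerCentralSeries, map_top_equiv]

/-- `γ` is antitone in the level. [folklore] -/
theorem γ_succ_le (m c : ℕ) : γ m (c + 1) ≤ γ m c :=
  Subgroup.lowerCentralSeries_antitone ⊤ (Nat.le_succ (c + 1))

/-- `γ m c ≤ γ₂ = (⊤).lowerCentralSeries 1`. [folklore] -/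
theorem γ_le_commutator (m c : ℕ) : γ m c ≤ (⊤ : Subgroup (S m)).lowerCentralSeries 1 :=
  Subgroup.lowerCentralSeries_antitone ⊤ (Nat.succ_le_succ (Nat.zero_le c))

-- adapted from Lines/joint-levine-inclusion-exclusion.lean (planner skeleton, same crux): transport lemmas
/-- `map` along a composite automorphism. [folklore] -/
theorem map_trans {m : ℕ} (e₁ e₂ : S m ≃* S m) (K : Subgroup (S m)) :
    K.map (e₁.trans e₂).toMonoidHom = (K.map e₁.toMonoidHom).map e₂.toMonoidHom := by
  rw [Subgroup.map_map]; rfl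

/-- `map` along `ψ.symm` then `ψ` is the identity. [folklore] -/
theorem map_symm_map {m : ℕ} (ψ : S m ≃* S m) (K : Subgroup (S m)) :
    (K.map ψ.symm.toMonoidHom).map ψ.toMonoidHom = K := by
  rw [← map_trans, MulEquiv.symm_trans_self]
  ext x
  simp

/-- `map` along `ψ` then `ψ.symm` is the identity. [folklore] -/
theorem map_map_symm {m : ℕ} (ψ : S m ≃* S m) (K : Subgroup (S m)) :
    (K.map ψ.toMonoidHom).map ψ.symm.toMonoidHom = K := by
  rw [← map_trans, MulEquiv.self_trans_symm]
  ext x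
  simp

/-- Transport of a normal-closure subgroup along an automorphism. [folklore] -/
theorem map_normalClosure_eq {m : ℕ} (α : S m ≃* S m) (s : Set (S m)) :
    (normalClosure s).map α.toMonoidHom = normalClosure (α '' s) := by
  rw [Subgroup.map_normalClosure _ _ (by exact α.surjective)]
  rfl

/-- The image of a subgroup as a set. [folklore] -/
theorem image_coe_eq {m : ℕ} {α : S m ≃* S m} {K K' : Subgroup (S m)}
    (h : K.map α.toMonoidHom = K') : α '' (K : Set (S m)) = (K' : Set (S m)) := by
  rw [← h]
  rfl

/-- Freeness of a normal-closure quotient is transported along an automorphism. [folklore] -/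
theorem isFreeOfRank_transport {m k : ℕ} (α : S m ≃* S m) {s t : Set (S m)} (h : α '' s = t)
    (hs : IsFreeOfRank (S m ⧸ normalClosure s) k) : IsFreeOfRank (S m ⧸ normalClosure t) k := by
  refine hs.of_mulEquiv (QuotientGroup.congr (normalClosure s) (normalClosure t) α ?_)
  change (normalClosure s).map α.toMonoidHom = normalClosure t
  rw [map_normalClosure_eq, h]

/-- For normal `P`, `⟪P⟫ = P`: the two spellings of the quotient agree. [folklore] -/
theorem isFreeOfRank_quotient_iff {m k : ℕ} (P : Subgroup (S m)) [P.Normal] :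
    IsFreeOfRank (S m ⧸ normalClosure (P : Set (S m))) k ↔ IsFreeOfRank (S m ⧸ P) k :=
  ⟨fun h => h.of_mulEquiv (QuotientGroup.quotientMulEquivOfEq (normalClosure_eq_self P)),
    fun h => h.of_mulEquiv (QuotientGroup.quotientMulEquivOfEq (normalClosure_eq_self P).symm)⟩

/-- Iso-transport of the level-`c` statement: if `ψ` standardises level `c` of `K`, then `K' = ψ⁻¹K` has level `c`
standard ON THE NOSE. [folklore] -/
theorem onTheNose_of_shadow {m c : ℕ} {K : TrisectionKernels (3 + 3 * m)} {ψ : S m ≃* S m}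
    (hψ : ∀ i : Fin 3, (N m i ⊔ γ m c).map ψ.toMonoidHom = K i ⊔ γ m c) (i : Fin 3) :
    (K i).map ψ.symm.toMonoidHom ⊔ γ m c = N m i ⊔ γ m c := by
  have h := congrArg (Subgroup.map ψ.symm.toMonoidHom) (hψ i)
  rw [map_map_symm, Subgroup.map_sup, map_γ] at h
  exact h.symm

/-! ## The dictionary (proved): REACH data ⇒ the level step, via `CutNormalForm` + `NoHiddenDepth` + Dedekind -/

/-- `⁅A ⊔ γ m c, ⊤⁆ ≤ A` for a normal `A` containing `γ m (c+1)`: the commutator identity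
`⁅a z, q⁆ = a ⁅z, q⁆ a⁻¹ ⁅a, q⁆`. [folklore] -/
theorem commutator_sup_γ_le {m c : ℕ} (A : Subgroup (S m)) [A.Normal] (hA : γ m (c + 1) ≤ A) :
    ⁅A ⊔ γ m c, (⊤ : Subgroup (S m))⁆ ≤ A := by
  rw [Subgroup.commutator_le]
  intro p hp q _
  obtain ⟨a, ha, z, hz, rfl⟩ := Subgroup.mem_sup_of_normal_left.1 hp
  have hzq : ⁅z, q⁆ ∈ A := hA (by
    change ⁅z, q⁆ ∈ ⁅γ m c, (⊤ : Subgroup (S m))⁆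
    exact Subgroup.commutator_mem_commutator hz (Subgroup.mem_top q))
  have haq : ⁅a, q⁆ ∈ A := by
    have h2 := A.mul_mem ha (‹A.Normal›.conj_mem a⁻¹ (A.inv_mem ha) q)
    simpa [commutatorElement_def, mul_assoc] using h2
  have key : ⁅a * z, q⁆ = a * ⁅z, q⁆ * a⁻¹ * ⁅a, q⁆ := by
    simp only [commutatorElement_def]; group
  rw [key]
  exact A.mul_mem (A.mul_mem (A.mul_mem ha hzq) (A.inv_mem ha)) haq

/-- **THE DICTIONARY.** For an honest kernel triple `K` with level `c` standard on the nose, an automorphism `ψ`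
stabilising the three level-`c` shadows and throwing the cut letters of `Cᵢ` into `Kᵢ·γ_{c+3}` satisfies
`ψ(Nᵢ·γ_{c+3}) = Kᵢ·γ_{c+3}`. (`≤`: `Nᵢ = ⟪Cᵢ⟫` by `CutNormalForm`. `≥`: `Kᵢγ' ≤ ψ(Nᵢ)γ' · γ` by the level-`c`
hypotheses; a `γ`-correction `z ∈ Kᵢγ' ∩ γ` is `k·y` with `k ∈ Kᵢ ∩ γ ≤ Kᵢ ∩ γ₂ ≤ [Kᵢ, S]` (`NoHiddenDepth`, honest `Kᵢ`)
`≤ [ψ(Nᵢ)γ'·γ, S] ≤ ψ(Nᵢ)γ'` — Dedekind.) [folklore] -/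
theorem dictionary (hcut : CutNormalForm) (hnhd : NoHiddenDepth) {m c : ℕ}
    (K : TrisectionKernels (3 + 3 * m)) (hn : ∀ i, (K i).Normal)
    (hfree : ∀ i, IsFreeOfRank (S m ⧸ normalClosure (K i : Set (S m))) (3 + 3 * m))
    (hnose : ∀ i, K i ⊔ γ m c = N m i ⊔ γ m c) (ψ : S m ≃* S m)
    (hstab : ∀ i : Fin 3, (N m i ⊔ γ m c).map ψ.toMonoidHom = N m i ⊔ γ m c)
    (hcutIn : ∀ i : Fin 3, ∀ x ∈ C m i, ψ (PresentedGroup.of x) ∈ K i ⊔ γ m (c + 1)) (i : Fin 3) :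
    (N m i ⊔ γ m (c + 1)).map ψ.toMonoidHom = K i ⊔ γ m (c + 1) := by
  haveI := hn i
  haveI hAn : ((N m i ⊔ γ m (c + 1)).map ψ.toMonoidHom).Normal :=
    Subgroup.Normal.map inferInstance _ ψ.surjective
  have hAeq : (N m i ⊔ γ m (c + 1)).map ψ.toMonoidHom = (N m i).map ψ.toMonoidHom ⊔ γ m (c + 1) := by
    rw [Subgroup.map_sup, map_γ]
  -- `≤`
  have hAB : (N m i ⊔ γ m (c + 1)).map ψ.toMonoidHom ≤ K i ⊔ γ m (c + 1) := by
    rw [hAeq]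
    refine sup_le ?_ le_sup_right
    rw [hcut m i, map_normalClosure_eq]
    refine Subgroup.normalClosure_le_normal ?_
    rintro _ ⟨_, ⟨x, hx, rfl⟩, rfl⟩
    exact hcutIn i x hx
  refine le_antisymm hAB ?_
  -- `≥`: first `Kᵢ ⊔ γ' ≤ A ⊔ γ`
  have hAγ : (N m i ⊔ γ m (c + 1)).map ψ.toMonoidHom ⊔ γ m c = K i ⊔ γ m c := by
    have e : (N m i).map ψ.toMonoidHom ⊔ γ m c = (N m i ⊔ γ m c).map ψ.toMonoidHom := by
      rw [Subgroup.map_sup, map_γ]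
    rw [hAeq, sup_assoc, sup_eq_right.2 (γ_succ_le m c), e, hstab i, hnose i]
  have hγ'A : γ m (c + 1) ≤ (N m i ⊔ γ m (c + 1)).map ψ.toMonoidHom := by
    rw [hAeq]; exact le_sup_right
  -- the honest kernel `Kᵢ` has no hidden depth: `Kᵢ ∩ γ ≤ A`
  have hKγ : K i ⊓ γ m c ≤ (N m i ⊔ γ m (c + 1)).map ψ.toMonoidHom := by
    intro k hk
    have hk2 : k ∈ K i ⊓ (⊤ : Subgroup (S m)).lowerCentralSeries 1 := ⟨hk.1, γ_le_commutator m c hk.2⟩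
    have hfree' : IsFreeOfRank (S m ⧸ K i) (3 + 3 * m) := (isFreeOfRank_quotient_iff (K i)).1 (hfree i)
    have hk3 : k ∈ ⁅K i, (⊤ : Subgroup (S m))⁆ := hnhd (3 + 3 * m) (3 + 3 * m) (K i) hfree' hk2
    have hle : ⁅K i, (⊤ : Subgroup (S m))⁆ ≤ (N m i ⊔ γ m (c + 1)).map ψ.toMonoidHom := by
      refine (Subgroup.commutator_mono (le_sup_left.trans (hAγ.symm.le)) le_rfl).trans ?_
      exact commutator_sup_γ_le _ hγ'A
    exact hle hk3
  intro b hb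
  have hb' : b ∈ (N m i ⊔ γ m (c + 1)).map ψ.toMonoidHom ⊔ γ m c := by
    rw [hAγ]
    exact (sup_le_sup_left (γ_succ_le m c) (K i)) hb
  obtain ⟨a, ha, z, hz, rfl⟩ := Subgroup.mem_sup_of_normal_left.1 hb'
  have hzB : z ∈ K i ⊔ γ m (c + 1) := by
    have := (K i ⊔ γ m (c + 1)).mul_mem ((K i ⊔ γ m (c + 1)).inv_mem (hAB ha)) hb
    simpa using this
  obtain ⟨k, hk, y, hy, rfl⟩ := Subgroup.mem_sup_of_normal_right.1 hzB
  have hkγ : k ∈ γ m c := by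
    have := (γ m c).mul_mem hz ((γ m c).inv_mem (γ_succ_le m c hy))
    simpa using this
  exact Subgroup.mul_mem _ ha (Subgroup.mul_mem _ (hKγ ⟨hk, hkγ⟩) (hγ'A hy))

/-! ## The step and the descent (kernel-checked composition) -/

/-- **THE LEVEL STEP** from REACH at `(m, c)`: for an honest kernel triple, a standard level-`c` shadow gives a
standard level-`(c+1)` shadow (transport to on-the-nose along `ψ₀⁻¹`, REACH, dictionary, compose). This is where
`IsGroupTrisection.normal` / `free_quotient` / `free_pairQuotient` are consumed; no triple condition, no `PUnit`
(nilpotent Nakayama). [folklore] -/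
theorem step (hcut : CutNormalForm) (hnhd : NoHiddenDepth) {m c : ℕ} (hR : Reach m c)
    (K : TrisectionKernels (3 + 3 * m)) (hn : ∀ i, (K i).Normal)
    (hfree : ∀ i, IsFreeOfRank (S m ⧸ normalClosure (K i : Set (S m))) (3 + 3 * m))
    (hpair : ∀ i j : Fin 3, i ≠ j → IsFreeOfRank (K.pairQuotient i j) (m + 1))
    (hc : ShadowStdAt m K c) : ShadowStdAt m K (c + 1) := by
  obtain ⟨ψ₀, hψ₀⟩ := hc
  -- transport: K' = ψ₀⁻¹ K has level c standard on the nose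
  set K' : TrisectionKernels (3 + 3 * m) := fun i => (K i).map ψ₀.symm.toMonoidHom with hK'
  have hn' : ∀ i, (K' i).Normal := fun i => Subgroup.Normal.map (hn i) _ ψ₀.symm.surjective
  have hnose : ∀ i, K' i ⊔ γ m c = N m i ⊔ γ m c := fun i => onTheNose_of_shadow hψ₀ i
  have hfree' : ∀ i, IsFreeOfRank (S m ⧸ normalClosure (K' i : Set (S m))) (3 + 3 * m) := fun i =>
    isFreeOfRank_transport ψ₀.symm (image_coe_eq rfl) (hfree i)
  have hpair' : ∀ i j : Fin 3, i ≠ j → IsFreeOfRank (TrisectionKernels.pairQuotient K' i j) (m + 1) := by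
    intro i j hij
    refine isFreeOfRank_transport ψ₀.symm ?_ (hpair i j hij)
    rw [Set.image_union, image_coe_eq rfl, image_coe_eq rfl]
  -- REACH, then the dictionary
  obtain ⟨ψ, hstab, hcutIn⟩ := hR K' hn' hfree' hpair' hnose
  have hdict : ∀ i, (N m i ⊔ γ m (c + 1)).map ψ.toMonoidHom = K' i ⊔ γ m (c + 1) :=
    dictionary hcut hnhd K' hn' hfree' hnose ψ hstab hcutIn
  refine ⟨ψ.trans ψ₀, fun i => ?_⟩
  rw [map_trans, hdict i, Subgroup.map_sup, map_γ, hK', map_symm_map]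

/-- Every `(m, c)` has `d = c+1 ∈ {1, 2}` or `d ≥ 3`, so the three REACH statements give REACH everywhere. [folklore] -/
theorem reach_of_regimes (h1 : ReachOne) (h2 : ReachTwo) (hH : ReachHigher) (m c : ℕ) : Reach m c := by
  rcases c with _ | c
  · exact h1 m
  · rcases c with _ | c
    · exact h2 m
    · exact hH m (c + 2) (by omega)

/-- **The descent, any-group form.** For an honest kernel triple (in particular a balanced group trisection of ANY
group) a standard ABELIAN shadow propagates to every nilpotent level. The trivial group enters the crux only through
the base — compare `Negative.nilpotentShadowsStandardAnyGroup_false_of_cyclicTrisection` (for a `(3,1)` trisection of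
`ℤ/p` the base already fails, and by this theorem that is the only way the any-group statement can fail if REACH holds).
[folklore] -/
theorem shadowStdAt_of_abelian (hcut : CutNormalForm) (hnhd : NoHiddenDepth) (hR : ∀ m c, Reach m c) {m : ℕ}
    (K : TrisectionKernels (3 + 3 * m)) (hn : ∀ i, (K i).Normal)
    (hfree : ∀ i, IsFreeOfRank (S m ⧸ normalClosure (K i : Set (S m))) (3 + 3 * m))
    (hpair : ∀ i j : Fin 3, i ≠ j → IsFreeOfRank (K.pairQuotient i j) (m + 1))
    (h0 : ShadowStdAt m K 0) : ∀ c, ShadowStdAt m K c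
  | 0 => h0
  | c + 1 => step hcut hnhd (hR m c) K hn hfree hpair (shadowStdAt_of_abelian hcut hnhd hR K hn hfree hpair h0 c)

/-- The crux, level by level, from the route's base item and the six named statements. [folklore] -/
theorem descent (h0 : AbelianShadowStandard) (hcut : CutNormalForm) (hnhd : NoHiddenDepth) (h1 : ReachOne)
    (h2 : ReachTwo) (hH : ReachHigher) (m : ℕ)
    (K : TrisectionKernels (3 + 3 * m)) (hK : IsGroupTrisection (3 + 3 * m) (m + 1) (PUnit : Type) K) (c : ℕ) :
    ShadowStdAt m K c :=
  shadowStdAt_of_abelian hcut hnhd (reach_of_regimes h1 h2 hH) K hK.normal hK.free_quotient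
    hK.free_pairQuotient (h0 m K hK) c

/-- The base of the descent is the route item `AbelianShadowStandard` (stmt-SmoothPoincare4-14599), CLOSED in the tree by
`Summit.SmoothPoincare4.SmoothPoincare4.Theorems.AbelianShadowStandard.abelianShadowStandard_proof`. [folklore] -/
theorem abelianShadowStandard_base : AbelianShadowStandard :=
  Summit.SmoothPoincare4.SmoothPoincare4.Theorems.AbelianShadowStandard.abelianShadowStandard_proof

/-- **`NilpotentShadowsStandard_of`** — THE SKELETON: the crux BY NAME, unconditionally modulo the registered stubs, from
the LANDED base item `AbelianShadowStandard` (stmt-SmoothPoincare4-14599, `abelianShadowStandard_proof`), the LANDED stubs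
`stub_cutNormalForm` (p81513), `stub_noHiddenDepth` (p83145), `stub_johnsonGenerators` (p95690), `stub_magnusWittRead`
(p90021), `stub_levelOneGlue` (p95693) (⟹ `ReachOne`), and the registered open stubs `stub_reachTwo` (from 4a–4e),
`stub_reachHigher` (through their read-backs). When the stubs land as
Theorems, replace the `*_stub` constants by the landed names and propose this file sorry-free
(`--workitem stmt-SmoothPoincare4-14594`); it then closes the crux. [folklore] -/
theorem NilpotentShadowsStandard_of : NilpotentShadowsStandard :=
  fun m K hK c => descent abelianShadowStandard_base cutNormalForm_stub noHiddenDepth_stub reachOne_stub reachTwo_stub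
    reachHigher_stub m K hK c

/-! ## Certificates (sorry-free): consistency of the cut -/

/-- Non-vacuity: the hypotheses of every REACH stub are inhabited at every `(m, c)` by `K = N m`, and `ψ = 1`
realises the conclusion there (cut letters lie in `Nᵢ` by `CutNormalForm`; without it, by `stabilizeIter`'s
definition — we only record the shadow form here). [folklore] -/
theorem hypotheses_inhabited (m c : ℕ) :
    (∀ i, (N m i).Normal) ∧ (∀ i, IsFreeOfRank (S m ⧸ normalClosure (N m i : Set (S m))) (3 + 3 * m)) ∧
      (∀ i j : Fin 3, i ≠ j → IsFreeOfRank ((N m).pairQuotient i j) (m + 1)) ∧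
      (∀ i, N m i ⊔ γ m c = N m i ⊔ γ m c) ∧ ShadowStdAt m (N m) c :=
  ⟨(standard_isGroupTrisection m).normal, (standard_isGroupTrisection m).free_quotient,
    (standard_isGroupTrisection m).free_pairQuotient, fun _ => rfl, ⟨MulEquiv.refl _, fun i => by simp⟩⟩

/-- REACH is NECESSARY for the step (the converse of `dictionary`, trivially): if some `ψ` standardises level `c+1`
of an on-the-nose level-`c` triple then `ψ` stabilises the level-`c` shadows and throws cut letters into `Kᵢγ'`
(given `CutNormalForm` for "cut letters lie in `Nᵢ`"). So the REACH stubs are EQUIVALENT to the level steps, not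
strengthenings. [folklore] -/
theorem reach_necessary (hcut : CutNormalForm) {m c : ℕ} {K : TrisectionKernels (3 + 3 * m)}
    (hnose : ∀ i, K i ⊔ γ m c = N m i ⊔ γ m c) {ψ : S m ≃* S m}
    (hψ : ∀ i : Fin 3, (N m i ⊔ γ m (c + 1)).map ψ.toMonoidHom = K i ⊔ γ m (c + 1)) :
    (∀ i : Fin 3, (N m i ⊔ γ m c).map ψ.toMonoidHom = N m i ⊔ γ m c) ∧
      ∀ i : Fin 3, ∀ x ∈ C m i, ψ (PresentedGroup.of x) ∈ K i ⊔ γ m (c + 1) := by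
  refine ⟨fun i => ?_, fun i x hx => ?_⟩
  · have e1 : N m i ⊔ γ m c = (N m i ⊔ γ m (c + 1)) ⊔ γ m c := by
      rw [sup_assoc, sup_eq_right.2 (γ_succ_le m c)]
    calc (N m i ⊔ γ m c).map ψ.toMonoidHom
        = ((N m i ⊔ γ m (c + 1)) ⊔ γ m c).map ψ.toMonoidHom := by rw [← e1]
      _ = (K i ⊔ γ m (c + 1)) ⊔ γ m c := by rw [Subgroup.map_sup, hψ i, map_γ]
      _ = K i ⊔ γ m c := by rw [sup_assoc, sup_eq_right.2 (γ_succ_le m c)]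
      _ = N m i ⊔ γ m c := hnose i
  · rw [← hψ i]
    refine ⟨PresentedGroup.of x, Subgroup.mem_sup_left ?_, rfl⟩
    rw [hcut m i]
    exact Subgroup.subset_normalClosure ⟨x, hx, rfl⟩

/-- CHECK AGAINST THE LANDED NEGATIVE LEMMA `Negative.nilpotentShadowsStandard_false_without_trisection` (junk witness
`K = ⊤`): the junk kernel `⊤` is NOT honest (`S/⊤` is trivial, not free of rank `3 + 3m`), so it never enters a REACH
stub or the dictionary — the skeleton consumes `free_quotient` exactly where the disprover showed it must. [folklore] -/
theorem junk_not_honest (m : ℕ) :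
    ¬ IsFreeOfRank (S m ⧸ normalClosure ((⊤ : Subgroup (S m)) : Set (S m))) (3 + 3 * m) := by
  rintro ⟨e⟩
  have h1 : ∀ q : S m ⧸ normalClosure ((⊤ : Subgroup (S m)) : Set (S m)), q = 1 := by
    intro q
    obtain ⟨x, rfl⟩ := QuotientGroup.mk_surjective q
    exact (QuotientGroup.eq_one_iff x).2 (subset_normalClosure (Subgroup.mem_top x))
  have h01 : (FreeGroup.of (⟨0, by omega⟩ : Fin (3 + 3 * m)) : FreeGroup (Fin (3 + 3 * m))) = 1 :=
    e.injective (by rw [h1 (e _), h1 (e 1)])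
  exact FreeGroup.of_ne_one _ h01

/-- The level-`c` statement produced by the induction is literally the disprover's reading of the crux, so
`Negative.shadow_mono` / `counterexample_shape` apply to the partial results of the line. [folklore] -/
example (m : ℕ) (K : TrisectionKernels (3 + 3 * m)) (c : ℕ) :
    ShadowStdAt m K c ↔
      ∃ ψ : SurfaceGroup (3 + 3 * m) ≃* SurfaceGroup (3 + 3 * m), ∀ i : Fin 3,
        (s4Kernels.stabilizeIter m i ⊔
            (⊤ : Subgroup (SurfaceGroup (3 + 3 * m))).lowerCentralSeries (c + 1)).map ψ.toMonoidHom =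
          K i ⊔ (⊤ : Subgroup (SurfaceGroup (3 + 3 * m))).lowerCentralSeries (c + 1) :=
  Iff.rfl

end Summit.SmoothPoincare4.SmoothPoincare4.Cruxes.NilpotentShadowsStandard.SaturatedTorsorDescent

end
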